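import Summits.HubbardSuperconductivity.HubbardSuperconductivity.Theorems.BalabanIRBirComplexStableXYRSpinWave
import Summits.HubbardSuperconductivity.HubbardSuperconductivity.Theorems.BalabanIRBirComplexStableXYRCorePenalty
import Summits.HubbardSuperconductivity.HubbardSuperconductivity.Theorems.BalabanIRBirComplexStableXYRCovarianceFRDMatrix
import Literature.Probability.LatticeModels.TorusFormFiniteRangeDecomposition
import HarnessLib

/-!
# Crux `BirComplexStableXYR` (stmt-HubbardSuperconductivity-14845), blueprint M1: the real Gaussian
# backbone `Q_c` of an admissible table is a translation-invariant FINITE-RANGE form on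
# `(ℤ/L)² × ℤ/M` dominating `c₀Δ` — so the finite-range decomposition of the tree applies to it

Support file (prover seat 0, route BalabanIR) for the restated engine
`…Theses.BalabanIR.BirComplexStableXYR`, line `log-concave-core-bounded-phase`, blueprint milestone
**M1** (`Cruxes/BirComplexStableXYR/Lines/log-concave-core-bounded-phase.md` §3: "Finite-range /
block decomposition of the REAL covariance `(KQ)⁻¹` on `(ℤ/L)²×ℤ/M` respecting translations, (R),
(P) … for a general positive finite-range form `Q ≥ c₀Δ`").  The general theory is now in the tree
(`Literature/LinearAlgebra/Matrix/FiniteRangeDecompositionMatrix{,Sum}.lean` — Bauerschmidt 2013 on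
a finite set: pieces `C_j = g_j(Q) ⪰ 0`, functions of `Q`, finite range `½L_*^j·range(Q)`,
`Σ_j C_j + C_N^♭ = Q⁺ + a_NΠ₀`; `Literature/Probability/LatticeModels/TorusFormFiniteRangeDecomposition.lean`
— the torus assembly: averaging projection, finite range in the torus distance, kernel bound by
momentum sums of the comparison Laplacian).  This file discharges its hypotheses for the crux:
the translate-summed real Hessian at the constants,

  `u ↦ Re(−Σ_s Σ_n c_n (n·(u∘sh s))²) = u·Q_c u`,

is represented by an explicit real symmetric matrix `Q_c` (`sw_re_neg_sum_sq_eq_matrix`) which is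
translation-invariant (`sh (s+a) w = sh s w + a`), kills the constants ((U1): `Σ_w n_w = 0`), has
range `3(r−1)` in the `ℓ¹` torus distance (two sites interact only through a common window),
dominates `c₀ ×` the Dirichlet form along the three unit steps (`gaussianCoercive`), and is
bounded by `8r⁶·normA(c) ≤ 8r⁶B` (`win_abs_reHess_le` summed over windows) — `stub_frdBackbone`.
Consequently (`frdBackbone_finiteRange`, `frdBackbone_sum_eq`, `frdBackbone_abs_piece_le`) the pieces
`MatrixFRD.piece Q_c Θ L_* j` (`Θ = 4r⁶B + 1`) decompose `(Q_c)⁺` on mean-zero fields into positive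
translation-invariant finite-range parts, with entries bounded by explicit momentum sums over
`(k,q) ∈ (ℤ/L)²×ℤ/M` of any antitone majorant of the scale function at `c₀·2(ε_L(k)+ε_M(q))`.
No definitions. [folklore]
-/

noncomputable section

-- tree namespace Summit.HubbardSuperconductivity.HubbardSuperconductivity (D-0017)
set_option linter.dupNamespace false

namespace Summit.HubbardSuperconductivity.HubbardSuperconductivity.Theorems

open scoped BigOperators Matrix ComplexConjugate
open MeasureTheory Complex Summit.HubbardSuperconductivity.BirComplexStableXYNegative
open Literature.Probability.LatticeModels Literature.LinearAlgebra.Matrix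
open Literature.LinearAlgebra.Matrix.MatrixFRD

section FRDBackbone

variable {r : ℕ} {L M : ℕ} [NeZero L] [NeZero M]

-- `sh (s + a) w = sh s w + a` is `cfrd_sh_add` (BalabanIRBirComplexStableXYRCovarianceFRDMatrix).

omit [NeZero L] [NeZero M] in
/-- The window shift is the translation by the window offset: `sh s w = s + sh 0 w`. [folklore] -/
theorem frdb_sh_eq_add (s : Λ L M) (w : W r) : sh L M s w = s + sh L M 0 w := by
  have := cfrd_sh_add (0 : Λ L M) s w
  rw [zero_add] at this
  rw [this, add_comm]

/-- The window linear form in the site variables: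
`Σ_w n_w u(sh s w) = Σ_j (Σ_w n_w [sh s w = j]) u_j`. [folklore] -/
theorem frdb_window_form (n : Freq r) (u : Λ L M → ℝ) (s : Λ L M) :
    ∑ w, (n w : ℝ) * u (sh L M s w) =
      ∑ j, (∑ w, (n w : ℝ) * (if sh L M s w = j then (1 : ℝ) else 0)) * u j := by
  classical
  simp_rw [Finset.sum_mul, mul_assoc, ite_mul, one_mul, zero_mul]
  rw [Finset.sum_comm]
  refine Finset.sum_congr rfl fun w _ => ?_
  rw [← Finset.mul_sum]
  congr 1
  rw [Finset.sum_ite_eq]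
  simp

/-- The coefficient row of a window form sums to `Σ_w n_w`. [folklore] -/
theorem frdb_coeff_sum (n : Freq r) (s : Λ L M) :
    ∑ j : Λ L M, ∑ w, (n w : ℝ) * (if sh L M s w = j then (1 : ℝ) else 0) = ∑ w, (n w : ℝ) := by
  classical
  rw [Finset.sum_comm]
  refine Finset.sum_congr rfl fun w _ => ?_
  rw [← Finset.mul_sum, Finset.sum_ite_eq]
  simp

omit [NeZero L] [NeZero M] in
/-- A non-vanishing coefficient forces the site into the window. [folklore] -/
theorem frdb_exists_of_coeff_ne_zero (n : Freq r) (s x : Λ L M)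
    (h : ∑ w, (n w : ℝ) * (if sh L M s w = x then (1 : ℝ) else 0) ≠ 0) : ∃ w : W r, sh L M s w = x := by
  by_contra hno
  push Not at hno
  apply h
  refine Finset.sum_eq_zero fun w _ => ?_
  rw [if_neg (hno w), mul_zero]

/-- `|k|_L ≤ |k|` for an integer `k` read modulo `L` (minimality of `valMinAbs`). [folklore] -/
theorem frdb_natAbs_valMinAbs_intCast_le {n : ℕ} [NeZero n] (z : ℤ) :
    ((z : ZMod n).valMinAbs).natAbs ≤ z.natAbs :=
  ZMod.natAbs_min_of_le_div_two n _ z (ZMod.coe_valMinAbs _) (ZMod.natAbs_valMinAbs_le _)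

/-- Two sites of one window are at torus distance `≤ 3(r−1)`. [folklore] -/
theorem frdb_torusDist_sh_le (hr : 1 ≤ r) (s : Λ L M) (w w' : W r) :
    torusDist (sh L M s w) (sh L M s w') ≤ 3 * ((r : ℝ) - 1) := by
  have hfin : ∀ a b : Fin r, (((((a : ℕ) : ℤ) - ((b : ℕ) : ℤ)).natAbs : ℕ) : ℝ) ≤ (r : ℝ) - 1 := by
    intro a b
    have ha := a.isLt
    have hb := b.isLt
    have : (((a : ℕ) : ℤ) - ((b : ℕ) : ℤ)).natAbs ≤ r - 1 := by omega
    have hr' : ((r - 1 : ℕ) : ℝ) = (r : ℝ) - 1 := by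
      rw [Nat.cast_sub hr, Nat.cast_one]
    rw [← hr']
    exact_mod_cast this
  have hcoord : ∀ {n : ℕ} [NeZero n] (a b : Fin r),
      (((((a : ℕ) : ZMod n) - ((b : ℕ) : ZMod n)).valMinAbs.natAbs : ℕ) : ℝ) ≤ (r : ℝ) - 1 := by
    intro n _ a b
    have hz : (((a : ℕ) : ZMod n) - ((b : ℕ) : ZMod n)) = ((((a : ℕ) : ℤ) - ((b : ℕ) : ℤ) : ℤ) : ZMod n) := by
      push_cast
      rfl
    rw [hz]
    refine le_trans ?_ (hfin a b)
    exact_mod_cast frdb_natAbs_valMinAbs_intCast_le _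
  have c0 : ((sh L M s w).1 - (sh L M s w').1) 0 = ((w.1 : ℕ) : ZMod L) - ((w'.1 : ℕ) : ZMod L) := by
    simp [sh]
  have c1 : ((sh L M s w).1 - (sh L M s w').1) 1 =
      ((w.2.1 : ℕ) : ZMod L) - ((w'.2.1 : ℕ) : ZMod L) := by
    simp [sh]
  have c2 : (sh L M s w).2 - (sh L M s w').2 = ((w.2.2 : ℕ) : ZMod M) - ((w'.2.2 : ℕ) : ZMod M) := by
    simp [sh]
  unfold torusDist
  rw [Fin.sum_univ_two, c0, c1, c2]
  have h1 := hcoord (n := L) w.1 w'.1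
  have h2 := hcoord (n := L) w.2.1 w'.2.1
  have h3 := hcoord (n := M) w.2.2 w'.2.2
  linarith

/-- `ΣΣ(x_w − x_{w'})² ≤ 4r³ Σ_w x_w²`. [folklore] -/
theorem frdb_dir_le (x : W r → ℝ) :
    ∑ w, ∑ w', (x w - x w') ^ 2 ≤ 4 * (r : ℝ) ^ 3 * ∑ w, x w ^ 2 := by
  have hcard : ((Finset.univ : Finset (W r)).card : ℝ) = (r : ℝ) ^ 3 := by
    rw [Finset.card_univ]
    simp [Fintype.card_prod, Fintype.card_fin]
    ring
  have hA : ∑ w : W r, ∑ _w' : W r, (2 * x w ^ 2) = (r : ℝ) ^ 3 * (2 * ∑ w, x w ^ 2) := by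
    simp only [Finset.sum_const, nsmul_eq_mul, hcard]
    rw [Finset.mul_sum, Finset.mul_sum]
  have hB : ∑ _w : W r, ∑ w' : W r, (2 * x w' ^ 2) = (r : ℝ) ^ 3 * (2 * ∑ w, x w ^ 2) := by
    rw [Finset.sum_comm]
    exact hA
  calc ∑ w, ∑ w', (x w - x w') ^ 2 ≤ ∑ w, ∑ w', (2 * x w ^ 2 + 2 * x w' ^ 2) := by
        refine Finset.sum_le_sum fun w _ => Finset.sum_le_sum fun w' _ => ?_
        nlinarith [sq_nonneg (x w + x w')]
    _ = 4 * (r : ℝ) ^ 3 * ∑ w, x w ^ 2 := by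
        simp_rw [Finset.sum_add_distrib]
        rw [hA, hB]
        ring

/-- Each site is covered `r³` times by the windows: `Σ_s Σ_w f(sh s w) = r³ Σ_x f(x)`. [folklore] -/
theorem frdb_sum_sum_sh (f : Λ L M → ℝ) :
    ∑ s : Λ L M, ∑ w : W r, f (sh L M s w) = (r : ℝ) ^ 3 * ∑ x, f x := by
  rw [Finset.sum_comm]
  have h : ∀ w : W r, ∑ s : Λ L M, f (sh L M s w) = ∑ x, f x := by
    intro w
    have hfun : (fun s : Λ L M => f (sh L M s w)) = fun s => f (s + sh L M 0 w) :=
      funext fun s => by rw [frdb_sh_eq_add s w]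
    rw [hfun]
    exact Equiv.sum_comp (Equiv.addRight (sh L M 0 w)) f
  simp_rw [h]
  rw [Finset.sum_const, Finset.card_univ, nsmul_eq_mul]
  congr 1
  simp [Fintype.card_prod, Fintype.card_fin]
  ring

/-- **The summed Hessian at the constants is bounded by `8r⁶·normA`** (per window
`|Re H| ≤ 2normA·ΣΣ(ψ_w−ψ_{w'})²`, `win_abs_reHess_le`, then `ΣΣ ≤ 4r³Σψ²` and `r³`-fold covering).
[folklore] -/
theorem frdb_form_upper (c : Table r) (hU1 : ∀ n ∈ c.support, ∑ w, n w = 0) (u : Λ L M → ℝ) :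
    (-∑ s : Λ L M, c.sum (fun n a => a * (((∑ w, (n w : ℝ) * u (sh L M s w)) ^ 2 : ℝ) : ℂ))).re ≤
      8 * (r : ℝ) ^ 6 * normA c * ∑ x, u x ^ 2 := by
  have hwin : ∀ s : Λ L M,
      (-c.sum (fun n a => a * (((∑ w, (n w : ℝ) * u (sh L M s w)) ^ 2 : ℝ) : ℂ))).re ≤
        2 * normA c * ∑ w : W r, ∑ w' : W r, (u (sh L M s w) - u (sh L M s w')) ^ 2 := by
    intro s
    have h := CorePenalty.win_abs_reHess_le c hU1 (fun _ => (0 : ℝ)) (fun w => u (sh L M s w))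
    have hrew : (c.sum fun n a => a * (((∑ w, (n w : ℝ) * u (sh L M s w)) ^ 2 : ℝ) : ℂ) *
        Complex.exp (Complex.I * ((∑ w, (n w : ℝ) * (fun _ => (0 : ℝ)) w : ℝ) : ℂ))) =
        c.sum fun n a => a * (((∑ w, (n w : ℝ) * u (sh L M s w)) ^ 2 : ℝ) : ℂ) := by
      refine Finsupp.sum_congr fun n _ => ?_
      simp
    rw [hrew] at h
    exact (le_abs_self _).trans h
  calc (-∑ s : Λ L M, c.sum (fun n a => a * (((∑ w, (n w : ℝ) * u (sh L M s w)) ^ 2 : ℝ) : ℂ))).re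
      = ∑ s : Λ L M, (-c.sum (fun n a => a * (((∑ w, (n w : ℝ) * u (sh L M s w)) ^ 2 : ℝ) : ℂ))).re := by
        rw [← Finset.sum_neg_distrib, Complex.re_sum]
    _ ≤ ∑ s : Λ L M, 2 * normA c * (4 * (r : ℝ) ^ 3 * ∑ w : W r, u (sh L M s w) ^ 2) := by
        refine Finset.sum_le_sum fun s _ => (hwin s).trans ?_
        exact mul_le_mul_of_nonneg_left (frdb_dir_le _) (by have := normA_nonneg c; positivity)
    _ = 8 * (r : ℝ) ^ 6 * normA c * ∑ x, u x ^ 2 := by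
        rw [← Finset.mul_sum, ← Finset.mul_sum, frdb_sum_sum_sh (r := r) (fun x => u x ^ 2)]
        ring

/-- **`stub_frdBackbone` (seat-0 support stub of crux stmt-HubbardSuperconductivity-14845, blueprint M1).**
For an admissible table ((U1), (N), (A) `normA ≤ B`, (C) `c₀ > 0`, `r ≥ 2`) and every space-time torus
`(ℤ/L)² × ℤ/M`, the translate-summed real Hessian at the constants `u ↦ Re(−Σ_s Σ_n c_n (n·(u∘sh s))²)`
is the quadratic form of a real symmetric matrix `Q_c` which is translation-invariant, kills the
constants, has range `3(r−1)` in the `ℓ¹` torus distance, dominates `c₀ ×` the Dirichlet form along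
the three unit steps, and is bounded by `8r⁶B`: exactly the hypotheses of the tree's finite-range
decomposition on the torus (`Literature.Probability.LatticeModels.torusFRD_*`). [folklore] -/
theorem stub_frdBackbone :
    ∀ (r : ℕ) (B c₀ : ℝ), 2 ≤ r → 0 < c₀ → ∀ c : Table r,
      (∀ n ∈ c.support, ∑ w, n w = 0) → c.sum (fun _ a => a) = 0 → normA c ≤ B →
      (∀ φ : W r → ℝ, c₀ * ∑ w, ∑ w', (1 - Real.cos (φ w - φ w')) ≤ (genF c φ).re) →
      ∀ (L M : ℕ) [NeZero L] [NeZero M],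
      ∃ Q : Matrix (Λ L M) (Λ L M) ℝ,
        (∀ u : Λ L M → ℝ, u ⬝ᵥ Q *ᵥ u =
          (-∑ s : Λ L M, c.sum (fun n a =>
            a * (((∑ w, (n w : ℝ) * u (sh L M s w)) ^ 2 : ℝ) : ℂ))).re) ∧
        Q.IsHermitian ∧
        (∀ a x y : Λ L M, Q (x + a) (y + a) = Q x y) ∧
        Q *ᵥ (fun _ => (1 : ℝ)) = 0 ∧
        (∀ x y : Λ L M, 3 * ((r : ℝ) - 1) < torusDist x y → Q x y = 0) ∧
        (∀ u : Λ L M → ℝ, c₀ * ∑ i : Fin 3, ∑ s : Λ L M,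
          (u s - u (s + unitSteps 2 L M i)) ^ 2 ≤ u ⬝ᵥ Q *ᵥ u) ∧
        (∀ u : Λ L M → ℝ, u ⬝ᵥ Q *ᵥ u ≤ 2 * (4 * (r : ℝ) ^ 6 * B) * (u ⬝ᵥ u)) := by
  intro r B c₀ hr hc₀ c hU1 hN hA hC L M _ _
  classical
  -- the coefficient forms and the matrix
  set A : Λ L M × ↥c.support → Λ L M → ℝ :=
    fun k j => ∑ w, ((k.2 : Freq r) w : ℝ) * (if sh L M k.1 w = j then (1 : ℝ) else 0) with hAdef
  set Q : Matrix (Λ L M) (Λ L M) ℝ :=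
    Matrix.of fun i j => (-(∑ k : Λ L M × ↥c.support, c k.2 * (A k i : ℂ) * (A k j : ℂ))).re with hQ
  -- (form)
  have hform : ∀ u : Λ L M → ℝ, u ⬝ᵥ Q *ᵥ u =
      (-∑ s : Λ L M, c.sum (fun n a => a * (((∑ w, (n w : ℝ) * u (sh L M s w)) ^ 2 : ℝ) : ℂ))).re := by
    intro u
    have hsum : (∑ s : Λ L M, c.sum (fun n a =>
        a * (((∑ w, (n w : ℝ) * u (sh L M s w)) ^ 2 : ℝ) : ℂ))) =
        ∑ k : Λ L M × ↥c.support, c k.2 * ((∑ j, A k j * u j : ℝ) : ℂ) ^ 2 := by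
      conv_rhs => rw [Fintype.sum_prod_type]
      refine Fintype.sum_congr _ _ fun s => ?_
      rw [Finsupp.sum, ← Finset.sum_coe_sort]
      refine Fintype.sum_congr _ _ fun n => ?_
      dsimp only
      rw [frdb_window_form]
      simp only [hAdef]
      push_cast
      ring
    rw [hsum]
    exact (sw_re_neg_sum_sq_eq_matrix (fun k : Λ L M × ↥c.support => c k.2) A u).symm
  -- (translation invariance of the coefficient forms)
  have hAt : ∀ (s : Λ L M) (n : ↥c.support) (a x : Λ L M), A (s + a, n) (x + a) = A (s, n) x := by
    intro s n a x
    simp only [hAdef]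
    refine Finset.sum_congr rfl fun w _ => ?_
    simp only [cfrd_sh_add, add_left_inj]
  refine ⟨Q, hform, sw_matrix_isHermitian _ _, ?_, ?_, ?_, ?_, ?_⟩
  · -- translation invariance
    intro a x y
    simp only [hQ, Matrix.of_apply]
    congr 2
    rw [← Equiv.sum_comp (Equiv.prodCongr (Equiv.addRight a) (Equiv.refl (↥c.support)))
      (fun k => c k.2 * (A k (x + a) : ℂ) * (A k (y + a) : ℂ))]
    refine Finset.sum_congr rfl fun k _ => ?_
    obtain ⟨s, n⟩ := k
    show c (Prod.map (fun x => x + a) id (s, n)).2 * (A (Prod.map (fun x => x + a) id (s, n)) (x + a) : ℂ) *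
        (A (Prod.map (fun x => x + a) id (s, n)) (y + a) : ℂ) = c n * (A (s, n) x : ℂ) * (A (s, n) y : ℂ)
    change c n * (A (s + a, n) (x + a) : ℂ) * (A (s + a, n) (y + a) : ℂ) = _
    rw [hAt s n a x, hAt s n a y]
  · -- the constants are in the kernel
    funext x
    simp only [Matrix.mulVec, dotProduct, mul_one, hQ, Matrix.of_apply, Pi.zero_apply]
    rw [← Complex.re_sum]
    have : ∑ y : Λ L M, -(∑ k : Λ L M × ↥c.support, c k.2 * (A k x : ℂ) * (A k y : ℂ)) = 0 := by
      rw [Finset.sum_neg_distrib, neg_eq_zero, Finset.sum_comm]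
      refine Finset.sum_eq_zero fun k _ => ?_
      rw [← Finset.mul_sum]
      have hrow : ∑ y : Λ L M, (A k y : ℂ) = 0 := by
        rw [← Complex.ofReal_sum]
        simp only [hAdef]
        rw [frdb_coeff_sum]
        have hz := hU1 k.2 k.2.2
        have hz' : (∑ w, ((k.2 : Freq r) w : ℝ)) = 0 := by exact_mod_cast hz
        rw [hz', Complex.ofReal_zero]
      rw [hrow, mul_zero]
    rw [this, Complex.zero_re]
  · -- finite range
    intro x y hxy
    simp only [hQ, Matrix.of_apply]
    have hzero : ∀ k : Λ L M × ↥c.support, c k.2 * (A k x : ℂ) * (A k y : ℂ) = 0 := by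
      intro k
      by_cases hx : A k x = 0
      · rw [hx]; simp
      by_cases hy : A k y = 0
      · rw [hy]; simp
      exfalso
      obtain ⟨w, hw⟩ := frdb_exists_of_coeff_ne_zero (k.2 : Freq r) k.1 x hx
      obtain ⟨w', hw'⟩ := frdb_exists_of_coeff_ne_zero (k.2 : Freq r) k.1 y hy
      have hd := frdb_torusDist_sh_le (L := L) (M := M) (by omega : 1 ≤ r) k.1 w w'
      rw [hw, hw'] at hd
      linarith
    rw [Finset.sum_eq_zero fun k _ => hzero k]
    simp
  · -- lower bound along the unit steps
    intro u
    have hg := gaussianCoercive hr c hc₀ hN hC L M u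
    rw [hform u]
    refine le_trans (le_of_eq ?_) hg
    congr 1
    rw [Fin.sum_univ_three]
    have e0 : unitSteps 2 L M (0 : Fin 3) = (![1, 0], 0) := by
      rw [show (0 : Fin 3) = (0 : Fin 2).castSucc from rfl, unitSteps_castSucc]
      refine Prod.ext ?_ rfl
      funext i
      fin_cases i <;> simp
    have e1 : unitSteps 2 L M (1 : Fin 3) = (![0, 1], 0) := by
      rw [show (1 : Fin 3) = (1 : Fin 2).castSucc from rfl, unitSteps_castSucc]
      refine Prod.ext ?_ rfl
      funext i
      fin_cases i <;> simp
    have e2 : unitSteps 2 L M (2 : Fin 3) = (0, 1) := by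
      rw [show (2 : Fin 3) = Fin.last 2 from rfl, unitSteps_last]
    rw [e0, e1, e2, ← Finset.sum_add_distrib, ← Finset.sum_add_distrib]
  · -- upper bound
    intro u
    rw [hform u]
    have hB : normA c ≤ B := hA
    have hu : 0 ≤ u ⬝ᵥ u := by
      rw [dotProduct]
      exact Finset.sum_nonneg fun x _ => mul_self_nonneg _
    have hsq : ∑ x, u x ^ 2 = u ⬝ᵥ u := by
      rw [dotProduct]
      exact Finset.sum_congr rfl fun x _ => sq (u x)
    calc _ ≤ 8 * (r : ℝ) ^ 6 * normA c * ∑ x, u x ^ 2 := frdb_form_upper c hU1 u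
      _ ≤ 8 * (r : ℝ) ^ 6 * B * ∑ x, u x ^ 2 := by
          rw [hsq]
          exact mul_le_mul_of_nonneg_right
            (mul_le_mul_of_nonneg_left hB (by positivity)) hu
      _ = 2 * (4 * (r : ℝ) ^ 6 * B) * (u ⬝ᵥ u) := by rw [hsq]; ring

end FRDBackbone

end Summit.HubbardSuperconductivity.HubbardSuperconductivity.Theorems

end
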